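/-
Origin: expansion seat `planner-pub-hodgecm-mc-theta-3-g5-0`, handover #1 07:10Z md5 3c39adbbbe89 (331 l.; RE-FREEZE #2, final; history 4a4b58b481a4 → 2f8aace86915 (+§ 1 Frame `schwartzCongr`) → 3c39adbbbe89 (+ INTERTWINER forms: the dictionary between the junction's LOCAL model 𝓢(ℝ³) and E's carrier 𝓢((Fin 3 → mixedSpace L⁺), ℂ) = 𝓢(ℝ^{3g}) is a continuous ℂ-linear intertwiner `j`, not an isomorphism, whenever g = [L⁺:ℚ] ≥ 2 — which is the whole regime branch (`HermSpace3.isAnisotropic` needs 4 ≤ [L:ℚ]; witness `GoodSexticWitness` has g = 3)); NEW additive PKG Model leaf, ns HodgeCM.Model (+ .Transport, .ArchKTypeData); imports `HodgeCM.Model.ThetaHolDirections` only. § 1 generic push-forward along a continuous linear map `j : E →L F`: `Transport.differentiableAt_apply_map` (weak real-differentiability through every REAL continuous functional of E ⇒ through every ℂ-continuous functional of F after `j`), `tendsto_inv_smul_map_sub`, `exists_slopes_map` (difference-quotient limits and `D + I•Dᵢ = 0` push forward), `map_add_I_smul_eq_zero`; equivalence case `Transport.conjBy τ R g = τ ∘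 R g ∘ τ⁻¹` (`conjBy_apply[_apply]`, `conjBy_comp`, `differentiableAt_apply_conjBy`, `tendsto_inv_smul_conjBy_sub`, `exists_slopes_conjBy[']`); § 1 (Frame) `Transport.schwartzCongr 𝕜 (g : D ≃L[ℝ] D') : 𝓢(D, W) ≃L[𝕜] 𝓢(D', W)` (both directions of Mathlib's `SchwartzMap.compCLMOfContinuousLinearEquiv`; `schwartzCongr_apply`, `schwartzCongr_symm_apply`, `coe_schwartzCongr[_symm]`). § 2 sockets over `C : ArchKTypeData X k N`: `isWeaklyPDiff_of_intertwiner (j : E →L[ℂ] 𝓢((X.J → mixedSpace X.K), ℂ)) (R : P' → E →ₗ[ℂ] E) (Φ₁ : Module.Dual ℂ X.W → E) (hΦ : ∀ ℓ, C.Φarch ℓ = j (Φ₁ ℓ)) (hω : ∀ b ℓ, C.ωinf (e b) (j (Φ₁ ℓ)) = j (R b (Φ₁ ℓ))) (h : ∀ (T : E →L[ℝ] ℂ) ℓ, DifferentiableAt ℝ (fun b => T (R b (Φ₁ ℓ))) 0) : C.IsWeaklyPDiff e`, `isPMinusKilledAlong_of_intertwiner … (v) (h : ∀ ℓ, ∃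 D Dᵢ : E, Tendsto (fun t => t⁻¹ • (R (t • v) (Φ₁ ℓ) - Φ₁ ℓ)) (𝓝[≠] 0) (𝓝 D) ∧ Tendsto (… t • (I • v) …) (𝓝[≠] 0) (𝓝 Dᵢ) ∧ D + I • Dᵢ = 0) : C.IsPMinusKilledAlong e v`, `isPMinusKilled_of_intertwiner` (all v); and the equivalence forms `isWeaklyPDiff_of_ωinf_eq_conjBy` / `isPMinusKilledAlong_of_ωinf_eq_conjBy` / `isPMinusKilled_of_ωinf_eq_conjBy` (hypothesis `hω : ∀ b Ψ, C.ωinf (e b) Ψ = conjBy τ R b Ψ`; statements unchanged since 4a4b58b481a4, now corollaries). 2 explicit defs (`conjBy`, `schwartzCongr`) + 21 theorems, 0 Prop defs, 0 records, 0 cited binders, MODEL-N ±0; loose rc 0 / 0 warnings / build rc 0 (olean 681168 B) on installed PKG (v1 mirror), loose2 rc 0 under the v2 joint-cut mirror, `#print axioms` 11/11 = [propext, Classical.choice, Quot.sound] (`work/scratch/ax_transport.lean`), 0 proof-hole) (`HOME/mc/pub-hodgecm-mc-theta-3-g5/lean/stage/HodgeCM/Model/ArchKTypeTransport.lean`, md5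 3c39adbb, 331 lines);
landed by the gen-11 packager (p-g11) in gate run 35 as `HodgeCM/Model/ArchKTypeTransport.lean` (verbatim).
-/
/-
Copyright (c) 2026. Released under Apache 2.0 license as described in the file LICENSE.
Cell pub-hodgecm, MODEL layer (construction prover mc-theta-3, gen 5), node W6b-hol (ASM) of `MODEL-DAG.md`:
transport of the (AN) / (REP) socket hypotheses of `ArchKTypeData` along a continuous linear INTERTWINER from a
local archimedean model into E's archimedean Schwartz model.
-/
import Summits.HodgeConjecture.HodgeCM.Model.ThetaHolDirections

/-!
# Transport of (AN) and (REP) along an intertwiner into the archimedean model (W6b-hol, ASM — pin side)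

E's holomorphy binder `hol` is assembled (`Model/ThetaHolAssembly`, `Model/ThetaHolDirections`) from two
properties of the archimedean `K`-type datum `C : ArchKTypeData X k N` along a chart `e : P' → G₁`:
(AN) `C.IsWeaklyPDiff e` and (REP) `C.IsPMinusKilledAlong e v` (two directions suffice).  Both are statements
about the vectors `C.ωinf (e b) (C.Φarch ℓ)` of E's archimedean Schwartz model
`𝓢((X.J → mixedSpace X.K), ℂ) = 𝓢(K_∞^J)`, `K = L⁺`, i.e. Schwartz functions of `3g` real variables,
`g = [L⁺ : ℚ]` — and in the regime branch of the pin (`IsAnisotropic L V.Hm`, automatic once `4 ≤ [L : ℚ]`,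
`HermSpace3.isAnisotropic`; non-vacuity witness `Model/GoodSexticWitness`, `g = 3`) one has `g ≥ 2`: the
archimedean Weil representation is a product over the `g` real places of `L⁺`, of type `U(2,1) × U(1)` at the
place under `ι₁` and of compact type at the `g - 1` others.
The representation-theoretic suppliers of (AN)/(REP) (the junction leaves `KonnoKonno2007/Junction*` over an
archimedean Weil datum of the dual pair `U(2,1) × U(1)`) act on the LOCAL model `E = 𝓢(ℝ³)` of the one
non-compact place and speak of a family of operators `R b : E →ₗ[ℂ] E`.  The dictionary between the two is
therefore NOT an isomorphism of Schwartz models in general but a continuous `ℂ`-linear INTERTWINER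
`j : E →L[ℂ] 𝓢(K_∞^J)` (for `g ≥ 2`: `Φ₁ ↦ Φ₁ ⊗ Φ_cpt`, the external product with the fixed vector at the compact
places, cf. the tree's `SchwartzMap.tensorFin`; for `g = 1`: an equivalence) together with
(i) the harmonic vectors lie in its range, `C.Φarch ℓ = j (Φ₁ ℓ)`, and (ii) `ω_∞` intertwines on them,
`C.ωinf (e b) (j (Φ₁ ℓ)) = j (R b (Φ₁ ℓ))` (`ω_∞(ι e b) = ω_{ι₁}(e b) ⊗ 1`).  Since E's sockets only ever
evaluate `ω_∞` on the harmonic vectors, (i) + (ii) suffice — no tensor-product theory of `𝓢` is needed.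

This file is that (elementary, purely topological-linear) TRANSPORT step, stated once so that no consumer
re-proves it inline:

* § 1 (generic) weak real-differentiability and difference-quotient limits PUSH FORWARD along a continuous
  linear map `j : E →L F` (`Transport.differentiableAt_apply_map`, `Transport.tendsto_inv_smul_map_sub`,
  `Transport.exists_slopes_map`), and the relation `D + i Dᵢ = 0` along a `ℂ`-linear one; the special case of
  an equivalence `τ : E ≃L[ℂ] F` is conjugation `Transport.conjBy τ R g = τ ∘ R g ∘ τ⁻¹`
  (`differentiableAt_apply_conjBy`, `tendsto_inv_smul_conjBy_sub`, `exists_slopes_conjBy[']`).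
* § 1 (Frame) `Transport.schwartzCongr 𝕜 g : 𝓢(D, W) ≃L[𝕜] 𝓢(D', W)` — the identification of Schwartz models
  induced by a real continuous linear frame `g : D ≃L[ℝ] D'` (`f ↦ f ∘ g⁻¹`; both directions of Mathlib's
  `SchwartzMap.compCLMOfContinuousLinearEquiv`), the `τ` of the `g = 1` case and the coordinate part of `j`.
* § 2 (the sockets) **`ArchKTypeData.isWeaklyPDiff_of_intertwiner`**,
  **`ArchKTypeData.isPMinusKilledAlong_of_intertwiner`**, `ArchKTypeData.isPMinusKilled_of_intertwiner`:
  under (i) `hΦ` and (ii) `hω`, (AN) resp. (REP along `v`) for `C` follow from the same-shaped statements for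
  `R` on the local model `E` at the vectors `Φ₁ ℓ`; and the equivalence forms
  `ArchKTypeData.isWeaklyPDiff_of_ωinf_eq_conjBy`, `isPMinusKilledAlong_of_ωinf_eq_conjBy`,
  `isPMinusKilled_of_ωinf_eq_conjBy` (identification `hω : ∀ b Ψ, C.ωinf (e b) Ψ = conjBy τ R b Ψ`).
  A consumer holding a pure-tensor identification `archRestr X k C.Γ₀ g = adelicTensorEnd (A g) LinearMap.id`
  first rewrites `C.ωinf` into `A` by `ArchKTypeData.ωinf_apply_of_eq_adelicTensorEnd` (leaf
  `Model/ArchKTypePinTensor`) and then supplies (i)/(ii) for `A`.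

Nothing is cited and nothing is minted: kernel lemmas over the installed definitions.
-/

set_option autoImplicit false

noncomputable section

open Filter Topology
open scoped Classical SchwartzMap
open MulAction NumberField.mixedEmbedding
open Literature.NumberTheory.Automorphic Literature.NumberTheory.Weil1964
open Literature.AlgebraicGeometry.HodgeTheory
open Literature.AlgebraicGeometry.ShimuraVarieties
open Literature.NumberTheory.Automorphic.PicardCM
open HodgeCM.PerL34.Seesaw HodgeCM.PerL34.RationalCoset HodgeCM.PerL34.SupplyAdelic
open HodgeCM.Model.SupplyInstance HodgeCM.Model.SupplyResidual
open HodgeCM.Model.ThetaSpace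

namespace HodgeCM
namespace Model

/-! ### § 1. Pushing (AN) / (REP) forward along a continuous linear map -/

namespace Transport

variable {E F : Type*} [AddCommGroup E] [Module ℂ E] [AddCommGroup F] [Module ℂ F]

/-- the `𝔭₋`-relation `D + i Dᵢ = 0` pushes forward along a complex-linear map. -/
theorem map_add_I_smul_eq_zero {M : Type*} [FunLike M E F] [LinearMapClass M ℂ E F] (j : M) {D Dᵢ : E}
    (h : D + Complex.I • Dᵢ = 0) : j D + Complex.I • j Dᵢ = 0 := by
  rw [← map_smul, ← map_add, h, map_zero]

variable [TopologicalSpace E] [TopologicalSpace F]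

section PushForward

variable [Module ℝ E] [IsScalarTower ℝ ℂ E] [Module ℝ F] [IsScalarTower ℝ ℂ F]
variable {P : Type*} [NormedAddCommGroup P] [NormedSpace ℝ P]

omit [Module ℂ E] [IsScalarTower ℝ ℂ E] in
/-- **weak real-differentiability pushes forward**: if `b ↦ T (u b)` is real-differentiable at `b₀` for every REAL
continuous functional `T` of `E`, then so is `b ↦ T (j (u b))` for every continuous (real- or complex-) linear
`j : E → F` and every complex continuous functional `T` of `F`. -/
theorem differentiableAt_apply_map (j : E →L[ℝ] F) {u : P → E} {b₀ : P}
    (h : ∀ T : E →L[ℝ] ℂ, DifferentiableAt ℝ (fun b => T (u b)) b₀) (T : F →L[ℂ] ℂ) :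
    DifferentiableAt ℝ (fun b => T (j (u b))) b₀ :=
  h ((T.restrictScalars ℝ).comp j)

omit [Module ℂ E] [Module ℂ F] [IsScalarTower ℝ ℂ E] [IsScalarTower ℝ ℂ F] in
/-- **difference-quotient limits push forward** along a continuous real-linear map (any filter). -/
theorem tendsto_inv_smul_map_sub (j : E →L[ℝ] F) {u : ℝ → E} {Φ D : E} {l : Filter ℝ}
    (h : Tendsto (fun t : ℝ => t⁻¹ • (u t - Φ)) l (𝓝 D)) :
    Tendsto (fun t : ℝ => t⁻¹ • (j (u t) - j Φ)) l (𝓝 (j D)) := by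
  have hj : ∀ t : ℝ, t⁻¹ • (j (u t) - j Φ) = j (t⁻¹ • (u t - Φ)) := fun t => by
    rw [← map_sub, j.map_smul]
  simp_rw [hj]
  exact (j.continuous.tendsto D).comp h

/-- **(REP) pushes forward** (the shape of `ArchKTypeData.IsPMinusKilledAlong`): difference-quotient limits
`D`, `Dᵢ` of two curves `u`, `uᵢ` at `Φ` with `D + i Dᵢ = 0` give the same for `j ∘ u`, `j ∘ uᵢ` at `j Φ`, with
limits `j D`, `j Dᵢ`. -/
theorem exists_slopes_map (j : E →L[ℂ] F) {u uᵢ : ℝ → E} {Φ : E}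
    (h : ∃ D Dᵢ : E, Tendsto (fun t : ℝ => t⁻¹ • (u t - Φ)) (𝓝[≠] 0) (𝓝 D) ∧
      Tendsto (fun t : ℝ => t⁻¹ • (uᵢ t - Φ)) (𝓝[≠] 0) (𝓝 Dᵢ) ∧ D + Complex.I • Dᵢ = 0) :
    ∃ D' Dᵢ' : F, Tendsto (fun t : ℝ => t⁻¹ • (j (u t) - j Φ)) (𝓝[≠] 0) (𝓝 D') ∧
      Tendsto (fun t : ℝ => t⁻¹ • (j (uᵢ t) - j Φ)) (𝓝[≠] 0) (𝓝 Dᵢ') ∧ D' + Complex.I • Dᵢ' = 0 := by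
  obtain ⟨D, Dᵢ, hD, hDᵢ, hsum⟩ := h
  exact ⟨j D, j Dᵢ, tendsto_inv_smul_map_sub (j.restrictScalars ℝ) hD,
    tendsto_inv_smul_map_sub (j.restrictScalars ℝ) hDᵢ, map_add_I_smul_eq_zero j hsum⟩

end PushForward

/-! #### The equivalence case: conjugating a family of operators -/

section Conj

variable {G : Type*}

/-- **Conjugation of a family of linear operators by a continuous linear equivalence**:
`conjBy τ R g = τ ∘ R g ∘ τ⁻¹`. -/
def conjBy (τ : E ≃L[ℂ] F) (R : G → E →ₗ[ℂ] E) : G → F →ₗ[ℂ] F :=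
  fun g => (τ : E →L[ℂ] F).toLinearMap ∘ₗ R g ∘ₗ (τ.symm : F →L[ℂ] E).toLinearMap

variable (τ : E ≃L[ℂ] F) (R : G → E →ₗ[ℂ] E)

/-- (Ported verbatim from the HodgeCMPerL package; no docstring in the source.) -/
@[simp] theorem conjBy_apply (g : G) (Ψ : F) : conjBy τ R g Ψ = τ (R g (τ.symm Ψ)) := rfl

/-- (Ported verbatim from the HodgeCMPerL package; no docstring in the source.) -/
theorem conjBy_apply_apply (g : G) (Φ : E) : conjBy τ R g (τ Φ) = τ (R g Φ) := by
  rw [conjBy_apply, ContinuousLinearEquiv.symm_apply_apply]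

/-- conjugation commutes with reindexing the family. -/
theorem conjBy_comp {P : Type*} (e : P → G) : conjBy τ (R ∘ e) = conjBy τ R ∘ e := rfl

variable [Module ℝ E] [IsScalarTower ℝ ℂ E] [Module ℝ F] [IsScalarTower ℝ ℂ F]

/-- **(AN) transports along `τ`**: weak real-differentiability of `b ↦ R b Φ` at `b₀` through every REAL
continuous functional of `E` (all `Φ : E`) gives weak real-differentiability of `b ↦ (τ R b τ⁻¹) Ψ` at `b₀`
through every complex continuous functional of `F` (all `Ψ : F`). -/
theorem differentiableAt_apply_conjBy {P : Type*} [NormedAddCommGroup P] [NormedSpace ℝ P] {b₀ : P}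
    (R : P → E →ₗ[ℂ] E) (h : ∀ (T : E →L[ℝ] ℂ) (Φ : E), DifferentiableAt ℝ (fun b => T (R b Φ)) b₀)
    (T : F →L[ℂ] ℂ) (Ψ : F) : DifferentiableAt ℝ (fun b => T (conjBy τ R b Ψ)) b₀ :=
  differentiableAt_apply_map ((τ : E →L[ℂ] F).restrictScalars ℝ) (u := fun b => R b (τ.symm Ψ))
    (fun T => h T (τ.symm Ψ)) T

/-- **difference-quotient limits transport along `τ`** (any curve `γ` in the index type, any filter). -/
theorem tendsto_inv_smul_conjBy_sub {γ : ℝ → G} {Φ D : E} {l : Filter ℝ}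
    (h : Tendsto (fun t : ℝ => t⁻¹ • (R (γ t) Φ - Φ)) l (𝓝 D)) :
    Tendsto (fun t : ℝ => t⁻¹ • (conjBy τ R (γ t) (τ Φ) - τ Φ)) l (𝓝 (τ D)) := by
  simp_rw [conjBy_apply_apply]
  exact tendsto_inv_smul_map_sub ((τ : E →L[ℂ] F).restrictScalars ℝ) (u := fun t => R (γ t) Φ) h

/-- **(REP) transports along `τ`**: difference-quotient limits `D`, `Dᵢ` of `R` at `Φ` along two curves with
`D + i Dᵢ = 0` give the same for the conjugate family at `τ Φ`, with limits `τ D`, `τ Dᵢ`. -/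
theorem exists_slopes_conjBy {γ γᵢ : ℝ → G} {Φ : E}
    (h : ∃ D Dᵢ : E, Tendsto (fun t : ℝ => t⁻¹ • (R (γ t) Φ - Φ)) (𝓝[≠] 0) (𝓝 D) ∧
      Tendsto (fun t : ℝ => t⁻¹ • (R (γᵢ t) Φ - Φ)) (𝓝[≠] 0) (𝓝 Dᵢ) ∧ D + Complex.I • Dᵢ = 0) :
    ∃ D' Dᵢ' : F, Tendsto (fun t : ℝ => t⁻¹ • (conjBy τ R (γ t) (τ Φ) - τ Φ)) (𝓝[≠] 0) (𝓝 D') ∧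
      Tendsto (fun t : ℝ => t⁻¹ • (conjBy τ R (γᵢ t) (τ Φ) - τ Φ)) (𝓝[≠] 0) (𝓝 Dᵢ') ∧
      D' + Complex.I • Dᵢ' = 0 := by
  simp_rw [conjBy_apply_apply]
  exact exists_slopes_map (τ : E →L[ℂ] F) (u := fun t => R (γ t) Φ) (uᵢ := fun t => R (γᵢ t) Φ) h

/-- `exists_slopes_conjBy` with the vector given on the `F` side (`Φ := τ⁻¹ Ψ`). -/
theorem exists_slopes_conjBy' {γ γᵢ : ℝ → G} (Ψ : F)
    (h : ∃ D Dᵢ : E, Tendsto (fun t : ℝ => t⁻¹ • (R (γ t) (τ.symm Ψ) - τ.symm Ψ)) (𝓝[≠] 0) (𝓝 D) ∧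
      Tendsto (fun t : ℝ => t⁻¹ • (R (γᵢ t) (τ.symm Ψ) - τ.symm Ψ)) (𝓝[≠] 0) (𝓝 Dᵢ) ∧
      D + Complex.I • Dᵢ = 0) :
    ∃ D' Dᵢ' : F, Tendsto (fun t : ℝ => t⁻¹ • (conjBy τ R (γ t) Ψ - Ψ)) (𝓝[≠] 0) (𝓝 D') ∧
      Tendsto (fun t : ℝ => t⁻¹ • (conjBy τ R (γᵢ t) Ψ - Ψ)) (𝓝[≠] 0) (𝓝 Dᵢ') ∧
      D' + Complex.I • Dᵢ' = 0 := by
  simpa only [ContinuousLinearEquiv.apply_symm_apply] using exists_slopes_conjBy τ R (Φ := τ.symm Ψ) h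

end Conj

/-! #### Frames: the identification of Schwartz models induced by a real-linear frame -/

section Frame

variable (𝕜 : Type*) [RCLike 𝕜] {D D' W : Type*} [NormedAddCommGroup D] [NormedSpace ℝ D]
  [NormedAddCommGroup D'] [NormedSpace ℝ D'] [NormedAddCommGroup W] [NormedSpace ℝ W] [NormedSpace 𝕜 W]
  [SMulCommClass ℝ 𝕜 W]

/-- **The continuous `𝕜`-linear equivalence of Schwartz spaces induced by a real continuous linear equivalence
of the base spaces** (a frame `g : D ≃L[ℝ] D'`): `f ↦ f ∘ g⁻¹`, inverse `f ↦ f ∘ g`.  Mathlib has the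
one-directional `SchwartzMap.compCLMOfContinuousLinearEquiv`; this packages the two directions (e.g.
`D = (junction index → ℝ)`, `D' = (X.J → mixedSpace X.K)` when `g = [L⁺:ℚ] = 1`, `𝕜 = ℂ`, `W = ℂ`). -/
def schwartzCongr (g : D ≃L[ℝ] D') : 𝓢(D, W) ≃L[𝕜] 𝓢(D', W) where
  toLinearMap := (SchwartzMap.compCLMOfContinuousLinearEquiv 𝕜 g.symm).toLinearMap
  invFun := SchwartzMap.compCLMOfContinuousLinearEquiv 𝕜 g
  left_inv f := by
    ext x
    simp [SchwartzMap.compCLMOfContinuousLinearEquiv_apply]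
  right_inv f := by
    ext x
    simp [SchwartzMap.compCLMOfContinuousLinearEquiv_apply]
  continuous_toFun := (SchwartzMap.compCLMOfContinuousLinearEquiv 𝕜 g.symm).continuous
  continuous_invFun := (SchwartzMap.compCLMOfContinuousLinearEquiv 𝕜 g).continuous

variable (g : D ≃L[ℝ] D')

/-- (Ported verbatim from the HodgeCMPerL package; no docstring in the source.) -/
@[simp] theorem schwartzCongr_apply (f : 𝓢(D, W)) (x : D') : schwartzCongr 𝕜 g f x = f (g.symm x) := rfl

/-- (Ported verbatim from the HodgeCMPerL package; no docstring in the source.) -/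
@[simp] theorem schwartzCongr_symm_apply (f : 𝓢(D', W)) (x : D) :
    (schwartzCongr 𝕜 g).symm f x = f (g x) := rfl

/-- (Ported verbatim from the HodgeCMPerL package; no docstring in the source.) -/
theorem coe_schwartzCongr : ((schwartzCongr 𝕜 (W := W) g : 𝓢(D, W) ≃L[𝕜] 𝓢(D', W)) :
    𝓢(D, W) →L[𝕜] 𝓢(D', W)) = SchwartzMap.compCLMOfContinuousLinearEquiv 𝕜 g.symm :=
  rfl

/-- (Ported verbatim from the HodgeCMPerL package; no docstring in the source.) -/
theorem coe_schwartzCongr_symm : (((schwartzCongr 𝕜 (W := W) g).symm : 𝓢(D', W) ≃L[𝕜] 𝓢(D, W)) :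
    𝓢(D', W) →L[𝕜] 𝓢(D, W)) = SchwartzMap.compCLMOfContinuousLinearEquiv 𝕜 g :=
  rfl

end Frame

end Transport

/-! ### § 2. The sockets: (AN) and (REP) for `C` from the same statements on a local model -/

section Sockets

open Transport

variable {U : Universe} {Lc : CMField} {ι₁ : Lc →+* ℂ} {V : HermSpace3 Lc ι₁} {c : SeesawCtx Lc}

namespace ArchKTypeData

variable {X : ThetaSpaceInput U V c} {k : Fin 4} {N : ℕ} (C : ArchKTypeData X k N)
variable {E : Type*} [AddCommGroup E] [Module ℂ E] [TopologicalSpace E] [Module ℝ E] [IsScalarTower ℝ ℂ E]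

/-- **(AN) transfers along an intertwiner `j : E →L[ℂ] 𝓢(K_∞^J)`**: if the harmonic vectors are `j`-images,
`C.Φarch ℓ = j (Φ₁ ℓ)`, if `ω_∞ ∘ e` intertwines with the local family `R` on them,
`C.ωinf (e b) (j (Φ₁ ℓ)) = j (R b (Φ₁ ℓ))`, and if `b ↦ T (R b (Φ₁ ℓ))` is real-differentiable at `0` for every
REAL continuous functional `T` of `E`, then `C` is (AN) along `e`. -/
theorem isWeaklyPDiff_of_intertwiner {P' : Type*} [NormedAddCommGroup P'] [NormedSpace ℝ P']
    {e : P' → X.G₁} (j : E →L[ℂ] 𝓢((X.J → mixedSpace X.K), ℂ)) (R : P' → E →ₗ[ℂ] E)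
    (Φ₁ : Module.Dual ℂ X.W → E) (hΦ : ∀ ℓ, C.Φarch ℓ = j (Φ₁ ℓ))
    (hω : ∀ (b : P') (ℓ : Module.Dual ℂ X.W), C.ωinf (e b) (j (Φ₁ ℓ)) = j (R b (Φ₁ ℓ)))
    (h : ∀ (T : E →L[ℝ] ℂ) (ℓ : Module.Dual ℂ X.W), DifferentiableAt ℝ (fun b => T (R b (Φ₁ ℓ))) 0) :
    C.IsWeaklyPDiff e := fun T ℓ => by
  simp_rw [hΦ, hω]
  exact differentiableAt_apply_map (j.restrictScalars ℝ) (u := fun b => R b (Φ₁ ℓ)) (fun T => h T ℓ) T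

/-- **(REP) along `v` transfers along an intertwiner `j`**: difference-quotient limits `D`, `Dᵢ : E` of the local
family `R` at `Φ₁ ℓ` along `t ↦ t v`, `t ↦ t (i v)` with `D + i Dᵢ = 0` give `C.IsPMinusKilledAlong e v`. -/
theorem isPMinusKilledAlong_of_intertwiner {P' : Type*} [NormedAddCommGroup P'] [NormedSpace ℝ P']
    [Module ℂ P'] {e : P' → X.G₁} (j : E →L[ℂ] 𝓢((X.J → mixedSpace X.K), ℂ)) (R : P' → E →ₗ[ℂ] E)
    (Φ₁ : Module.Dual ℂ X.W → E) (hΦ : ∀ ℓ, C.Φarch ℓ = j (Φ₁ ℓ))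
    (hω : ∀ (b : P') (ℓ : Module.Dual ℂ X.W), C.ωinf (e b) (j (Φ₁ ℓ)) = j (R b (Φ₁ ℓ))) (v : P')
    (h : ∀ ℓ : Module.Dual ℂ X.W, ∃ D Dᵢ : E,
      Tendsto (fun t : ℝ => t⁻¹ • (R (t • v) (Φ₁ ℓ) - Φ₁ ℓ)) (𝓝[≠] 0) (𝓝 D) ∧
      Tendsto (fun t : ℝ => t⁻¹ • (R (t • (Complex.I • v)) (Φ₁ ℓ) - Φ₁ ℓ)) (𝓝[≠] 0) (𝓝 Dᵢ) ∧
      D + Complex.I • Dᵢ = 0) :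
    C.IsPMinusKilledAlong e v := fun ℓ => by
  simp_rw [hΦ, hω]
  exact exists_slopes_map j (u := fun t => R (t • v) (Φ₁ ℓ)) (uᵢ := fun t => R (t • (Complex.I • v)) (Φ₁ ℓ))
    (h ℓ)

/-- **(REP) transfers along an intertwiner `j`** (all directions). -/
theorem isPMinusKilled_of_intertwiner {P' : Type*} [NormedAddCommGroup P'] [NormedSpace ℝ P']
    [Module ℂ P'] {e : P' → X.G₁} (j : E →L[ℂ] 𝓢((X.J → mixedSpace X.K), ℂ)) (R : P' → E →ₗ[ℂ] E)
    (Φ₁ : Module.Dual ℂ X.W → E) (hΦ : ∀ ℓ, C.Φarch ℓ = j (Φ₁ ℓ))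
    (hω : ∀ (b : P') (ℓ : Module.Dual ℂ X.W), C.ωinf (e b) (j (Φ₁ ℓ)) = j (R b (Φ₁ ℓ)))
    (h : ∀ (v : P') (ℓ : Module.Dual ℂ X.W), ∃ D Dᵢ : E,
      Tendsto (fun t : ℝ => t⁻¹ • (R (t • v) (Φ₁ ℓ) - Φ₁ ℓ)) (𝓝[≠] 0) (𝓝 D) ∧
      Tendsto (fun t : ℝ => t⁻¹ • (R (t • (Complex.I • v)) (Φ₁ ℓ) - Φ₁ ℓ)) (𝓝[≠] 0) (𝓝 Dᵢ) ∧
      D + Complex.I • Dᵢ = 0) :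
    C.IsPMinusKilled e :=
  (C.isPMinusKilled_iff e).2 fun v => C.isPMinusKilledAlong_of_intertwiner j R Φ₁ hΦ hω v (h v)

/-! #### The equivalence forms (`g = 1`, or a local model already equal to the full one) -/

/-- **(AN) transfers along an identification `ω_∞ ∘ e = τ R τ⁻¹`**: if `C.ωinf (e b) = τ ∘ R b ∘ τ⁻¹` pointwise
and `b ↦ T (R b Φ)` is real-differentiable at `0` for every REAL continuous functional `T` of `E` and every
`Φ : E`, then `C` is (AN) along `e`. -/
theorem isWeaklyPDiff_of_ωinf_eq_conjBy {P' : Type*} [NormedAddCommGroup P'] [NormedSpace ℝ P']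
    {e : P' → X.G₁} (τ : E ≃L[ℂ] 𝓢((X.J → mixedSpace X.K), ℂ)) (R : P' → E →ₗ[ℂ] E)
    (hω : ∀ (b : P') (Ψ : 𝓢((X.J → mixedSpace X.K), ℂ)), C.ωinf (e b) Ψ = conjBy τ R b Ψ)
    (h : ∀ (T : E →L[ℝ] ℂ) (Φ : E), DifferentiableAt ℝ (fun b => T (R b Φ)) 0) :
    C.IsWeaklyPDiff e :=
  C.isWeaklyPDiff_of_intertwiner (τ : E →L[ℂ] _) R (fun ℓ => τ.symm (C.Φarch ℓ))
    (fun ℓ => (τ.apply_symm_apply _).symm)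
    (fun b ℓ => by rw [ContinuousLinearEquiv.coe_coe, hω, conjBy_apply_apply]) fun T ℓ => h T _

/-- **(REP) along `v` transfers along an identification `ω_∞ ∘ e = τ R τ⁻¹`**: difference-quotient limits
`D`, `Dᵢ : E` of `R` at the pulled-back harmonic vector `τ⁻¹ (Φ_∞ ℓ)` along `t ↦ t v`, `t ↦ t (i v)` with
`D + i Dᵢ = 0` give `C.IsPMinusKilledAlong e v`. -/
theorem isPMinusKilledAlong_of_ωinf_eq_conjBy {P' : Type*} [NormedAddCommGroup P'] [NormedSpace ℝ P']
    [Module ℂ P'] {e : P' → X.G₁} (τ : E ≃L[ℂ] 𝓢((X.J → mixedSpace X.K), ℂ)) (R : P' → E →ₗ[ℂ] E)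
    (hω : ∀ (b : P') (Ψ : 𝓢((X.J → mixedSpace X.K), ℂ)), C.ωinf (e b) Ψ = conjBy τ R b Ψ) (v : P')
    (h : ∀ ℓ : Module.Dual ℂ X.W, ∃ D Dᵢ : E,
      Tendsto (fun t : ℝ => t⁻¹ • (R (t • v) (τ.symm (C.Φarch ℓ)) - τ.symm (C.Φarch ℓ))) (𝓝[≠] 0) (𝓝 D) ∧
      Tendsto (fun t : ℝ => t⁻¹ • (R (t • (Complex.I • v)) (τ.symm (C.Φarch ℓ)) - τ.symm (C.Φarch ℓ)))
        (𝓝[≠] 0) (𝓝 Dᵢ) ∧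
      D + Complex.I • Dᵢ = 0) :
    C.IsPMinusKilledAlong e v :=
  C.isPMinusKilledAlong_of_intertwiner (τ : E →L[ℂ] _) R (fun ℓ => τ.symm (C.Φarch ℓ))
    (fun ℓ => (τ.apply_symm_apply _).symm)
    (fun b ℓ => by rw [ContinuousLinearEquiv.coe_coe, hω, conjBy_apply_apply]) v h

/-- **(REP) transfers along an identification `ω_∞ ∘ e = τ R τ⁻¹`** (all directions). -/
theorem isPMinusKilled_of_ωinf_eq_conjBy {P' : Type*} [NormedAddCommGroup P'] [NormedSpace ℝ P']
    [Module ℂ P'] {e : P' → X.G₁} (τ : E ≃L[ℂ] 𝓢((X.J → mixedSpace X.K), ℂ)) (R : P' → E →ₗ[ℂ] E)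
    (hω : ∀ (b : P') (Ψ : 𝓢((X.J → mixedSpace X.K), ℂ)), C.ωinf (e b) Ψ = conjBy τ R b Ψ)
    (h : ∀ (v : P') (ℓ : Module.Dual ℂ X.W), ∃ D Dᵢ : E,
      Tendsto (fun t : ℝ => t⁻¹ • (R (t • v) (τ.symm (C.Φarch ℓ)) - τ.symm (C.Φarch ℓ))) (𝓝[≠] 0) (𝓝 D) ∧
      Tendsto (fun t : ℝ => t⁻¹ • (R (t • (Complex.I • v)) (τ.symm (C.Φarch ℓ)) - τ.symm (C.Φarch ℓ)))
        (𝓝[≠] 0) (𝓝 Dᵢ) ∧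
      D + Complex.I • Dᵢ = 0) :
    C.IsPMinusKilled e :=
  (C.isPMinusKilled_iff e).2 fun v => C.isPMinusKilledAlong_of_ωinf_eq_conjBy τ R hω v (h v)

end ArchKTypeData

end Sockets

end Model
end HodgeCM

end
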